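import Summits.QuantumFields.YangMills.Theorems.LuscherReductionTwistedTraceScalingFPWeightIntegrand
import HarnessLib

/-!
# (N2) THE LAPLACE EVALUATION OF THE FADDEEV–POPOV WEIGHT AT A SLICE POINT: two-sided Gaussian bounds
# (lane A of S-BASE, crux `TwistedTraceScaling` stmt-QuantumFields-20203, C4 INNER; design note `pub/ym-fleet/ym-luscher-20007-p1/COARSE-DESIGN.md` §23.9 (N2))

Assembly of the (N2) tool-chain.  Data: a base point `p* = (w*, c*)` (balanced stiff coordinate, slow coordinate), the tube point `U* = orthoTube P(c*) w*`, ON THE SLICE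
(`P_Γ w* = 0`), gauge width `s = δg β`, fat radii `ρ₁` (of `U*`) and `ρ β` (of the weight), a core radius `r` and a support radius `R₁`.  With the Laplace linear map in flat
based coordinates `A = P_Γ ∘ basedLin p* ∘ flatLin` (`…SliceTaylorBased`, `…FPWeightChart`), its coercivity constant `c = 1/(4C_L)` (`…SliceCoerciveBased`), the uniform
Taylor constant `M` (`exists_taylor_two_basedFn`) and `M' = M + 2‖basedLin p*‖`, `η = 3M'r/c`:
★★★ `fpWeight_laplace_bounds`:
  `(2π²)^{-n}·e^{−6nR₁²}·(I(1+η) − e^{−c²r²/2s²} I(1/2)) ≤ N(U*) ≤ (2π²)^{-n}·(I(1−η) + e^{−c²r²/4s²} I(1/4))`,  `I(a) = ∫ exp(−a‖Aw‖²/s²) dw`, `n = |sites| − 1`,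
under explicit smallness hypotheses (`‖p*‖`, `R₁` below the β-independent radii of the tool-chain; `ρ₁ + 8r ≤ ρ β`; `3(L−1)(ρ₁ + ρ β) ≤ R₁`; `M'R₁ ≤ c/4`; `r ≤ R₁ ≤ 1/2`).
The Gaussian values `I(a) = (πs²/a)^{3n/2}/normDet(A ∘ euclToPi)` are `…GaussianPi`; with `r = s·polylog`, all corrections are `O(s·polylog + L⁵(ρ β)²)` relative — N IS the
Gaussian `(2π²)^{-n}(πs²)^{3n/2}/normDet(A_{p*})` up to those factors (§23.9).  Steps: based average (`…RecordWeightRho`) → vacuum gnomonic chart (`…GaugeGroupGnChart`; other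
hemispheres and far parameters do not meet the fat tube: `…BasedNearOne`, `…FPWeightChart`) → integrand `𝟙·exp(−‖P_Γ fB(gnoParam w, p*)‖²/s²)` with `fB = linkEmbed w* + basedLin p*·ξ +
O(M‖ξ‖²)` (`…SliceTaylorBased`), cubic chart correction (`…FPWeightChart`), coercivity (`…SliceCoerciveBased`) → pointwise two-regime bounds → `laplace_sandwich` (`…LaplaceSandwich`)
and the density sandwich of `…GaugeGroupGaussianSandwich`.
HONEST FRAMING: analysis for a stub of a child of the CONDITIONAL reduction route R2b1 (the Faddeev–Popov normalisation of the tube of record); no spectral claim; C4 OPEN; not a gap,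
not Clay.
-/

set_option autoImplicit false

noncomputable section

open MeasureTheory Real
open scoped BigOperators
open Literature.MathematicalPhysics.QuantumFieldTheory
open Literature.MathematicalPhysics.QuantumLattice

namespace Summit.QuantumFields.YangMills.Theorems.FemtoTransferGap.TwoLattice.ConstTube

open Summit.QuantumFields.YangMills.Theorems.FemtoTransferGap
open Summit.QuantumFields.YangMills.Theorems.FemtoTransferGap.TwoLattice.Avg
open Summit.QuantumFields.YangMills.Theorems.FemtoTransferGap.TwoLattice.Stiff (LinkSpace)
open Summit.QuantumFields.YangMills.Theorems.FemtoTransferGap.TwoLattice.GnChart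
open Literature.MathematicalPhysics.QuantumFieldTheory.Balaban1983to89.T4CubeChartGnomonic (gnoPoint)

variable (L : ℕ) [NeZero L]

/-! ## §2 ★★★ The two-sided Laplace bounds -/
set_option maxHeartbeats 400000 in
/-- The pointwise hypotheses of the Laplace sandwich for the chart integrand: coercivity, core sandwich, off-core bound, support. [folklore] -/
theorem fpIntegrand_envelope_hyps (_hL : Nonempty (NzSite L)) {δ ρ δg : ℝ → ℝ} {β : ℝ} (hs : 0 < δg β)
    (p : balancedSubmodule L × (Fin 3 → Fin 3 → ℝ))
    -- tool-chain radii and constants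
    {εT M : ℝ} (hM0 : 0 ≤ M) (_hεT : 0 < εT)
    (hT : ∀ (ξ : basedSubmodule L) (q : balancedSubmodule L × (Fin 3 → Fin 3 → ℝ)), ‖ξ‖ < εT → ‖q‖ < εT →
      ‖basedFn L (ξ, q) - basedFn L (0, q) - basedLin L q ξ‖ ≤ M * ‖ξ‖ ^ 2)
    {εC : ℝ} (hC : ∀ q : balancedSubmodule L × (Fin 3 → Fin 3 → ℝ), ‖q‖ < εC →
      ∀ ξ : basedSubmodule L, ‖ξ‖ ≤ 4 * sliceConst L * ‖(gaugeModes L).starProjection (basedLin L q ξ)‖)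
    (hpT : ‖p‖ < εT) (hpC : ‖p‖ < εC) (hp40 : ‖p‖ ≤ 1 / 40)
    -- slice condition and fat-tube membership of the tube point
    (hslice : (gaugeModes L).starProjection (linkEmbed L (p.1 : Edge 3 L → Fin 3 → ℝ)) = 0)
    {ρ₁ : ℝ} (hU : tubePt L p ∈ fatTubeRho L δ (fun _ => ρ₁) β)
    -- radii
    {r R₁ : ℝ} (hr0 : 0 ≤ r) (hrR : r ≤ R₁) (hR1 : R₁ ≤ 1 / 2) (hR1T : R₁ < εT) (hcore : ρ₁ + 8 * r ≤ ρ β)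
    (hsupp : 3 * ((L : ℝ) - 1) * (ρ₁ + ρ β) ≤ R₁)
    (hθ : (M + 2 * ‖basedLin L p‖) * R₁ * (4 * sliceConst L) ≤ 1 / 4)  :
    let s := δg β
    let c := 1 / (4 * sliceConst L)
    let η := 3 * ((M + 2 * ‖basedLin L p‖) * r * (4 * sliceConst L))
    (∀ w : NzSite L → Fin 3 → ℝ, c * ‖w‖ ≤ ‖laplaceMap L p w‖) ∧
    (∀ w : NzSite L → Fin 3 → ℝ, ‖w‖ ≤ r →
      Real.exp (-((1 + η) * ‖laplaceMap L p w‖ ^ 2 / s ^ 2)) ≤ fpIntegrand L δ ρ δg β p w ∧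
        fpIntegrand L δ ρ δg β p w ≤ Real.exp (-((1 - η) * ‖laplaceMap L p w‖ ^ 2 / s ^ 2))) ∧
    (∀ w : NzSite L → Fin 3 → ℝ, r < ‖w‖ → fpIntegrand L δ ρ δg β p w ≤ Real.exp (-(‖laplaceMap L p w‖ ^ 2 / (2 * s ^ 2)))) ∧
    (∀ w : NzSite L → Fin 3 → ℝ, fpIntegrand L δ ρ δg β p w ≠ 0 → ‖w‖ ≤ R₁) := by
  intro s c η
  classical
  have hCpos := sliceConst_pos L
  have hM'0 : 0 ≤ (M + 2 * ‖basedLin L p‖) := by positivity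
  have hc0 : 0 < c := by show 0 < 1 / (4 * sliceConst L); positivity
  have hcinv : c * (4 * sliceConst L) = 1 := by show 1 / (4 * sliceConst L) * (4 * sliceConst L) = 1; field_simp
  -- (0) coercivity of `A`
  have hcoer : ∀ w : NzSite L → Fin 3 → ℝ, c * ‖w‖ ≤ ‖laplaceMap L p w‖ := fun w => by
    have h := hC p hpC (flatLin L w)
    rw [norm_flatLin] at h
    rw [laplaceMap_apply]
    show 1 / (4 * sliceConst L) * ‖w‖ ≤ _
    rw [div_mul_eq_mul_div, one_mul, div_le_iff₀ (by positivity)]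
    linarith
  -- (1) the remainder at a flat parameter `w` with `‖w‖ ≤ R₁`: `P fB(gnoParam w, p) = laplaceMap L p w + R`, `‖R‖ ≤ (M + 2 * ‖basedLin L p‖)‖w‖²`
  have hw_basic : ∀ w : NzSite L → Fin 3 → ℝ, ‖w‖ ≤ R₁ → ‖gnoParam L w‖ < εT ∧ ‖gnoParam L w‖ ≤ ‖w‖ := fun w hw =>
    ⟨lt_of_le_of_lt ((norm_gnoParam_le L w).trans hw) hR1T, norm_gnoParam_le L w⟩
  have hp1 : ‖p.1‖ ≤ 1 / 20 := (norm_fst_le p).trans (by linarith)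
  have hp2 : ‖p.2‖ ≤ 1 / 40 := (norm_snd_le p).trans hp40
  have hfB0 : basedFn L (0, p) = linkEmbed L (p.1 : Edge 3 L → Fin 3 → ℝ) := basedFn_zero_left L p hp1 hp2
  have hrem : ∀ w : NzSite L → Fin 3 → ℝ, ‖w‖ ≤ R₁ → ‖(gaugeModes L).starProjection (basedFn L (gnoParam L w, p)) - laplaceMap L p w‖ ≤ (M + 2 * ‖basedLin L p‖) * ‖w‖ ^ 2 := fun w hw => by
    obtain ⟨hξT, hξw⟩ := hw_basic w hw
    have hw1 : ‖w‖ ≤ 1 := hw.trans (by linarith)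
    have hw0 : 0 ≤ ‖w‖ := norm_nonneg w
    have h1 := hT (gnoParam L w) p hξT hpT
    rw [hfB0] at h1
    -- `P fB − laplaceMap L p w = P(fB − linkEmbed w* − basedLin ξ) + P basedLin (ξ − flatLin w)` (using `P linkEmbed w* = 0`)
    have hdec : (gaugeModes L).starProjection (basedFn L (gnoParam L w, p)) - laplaceMap L p w =
        (gaugeModes L).starProjection (basedFn L (gnoParam L w, p) - linkEmbed L (p.1 : Edge 3 L → Fin 3 → ℝ) - basedLin L p (gnoParam L w)) +
          (gaugeModes L).starProjection (basedLin L p (gnoParam L w - flatLin L w)) := by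
      rw [laplaceMap_apply, map_sub, map_sub, map_sub, map_sub, hslice]; abel
    rw [hdec]
    have e1 : ‖(gaugeModes L).starProjection (basedFn L (gnoParam L w, p) - linkEmbed L (p.1 : Edge 3 L → Fin 3 → ℝ) - basedLin L p (gnoParam L w))‖ ≤ M * ‖w‖ ^ 2 :=
      (Submodule.norm_starProjection_apply_le _ _).trans (h1.trans (by gcongr))
    have e2 : ‖(gaugeModes L).starProjection (basedLin L p (gnoParam L w - flatLin L w))‖ ≤ 2 * ‖basedLin L p‖ * ‖w‖ ^ 2 := by
      calc _ ≤ ‖basedLin L p (gnoParam L w - flatLin L w)‖ := Submodule.norm_starProjection_apply_le _ _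
        _ ≤ ‖basedLin L p‖ * ‖gnoParam L w - flatLin L w‖ := ContinuousLinearMap.le_opNorm _ _
        _ ≤ ‖basedLin L p‖ * (2 * ‖w‖ ^ 3) := mul_le_mul_of_nonneg_left (norm_gnoParam_sub_flatLin_le L w) (ContinuousLinearMap.opNorm_nonneg _)
        _ ≤ ‖basedLin L p‖ * (2 * ‖w‖ ^ 2) := by
            refine mul_le_mul_of_nonneg_left ?_ (ContinuousLinearMap.opNorm_nonneg _)
            nlinarith [pow_le_pow_left₀ hw0 hw1 2, sq_nonneg ‖w‖]
        _ = 2 * ‖basedLin L p‖ * ‖w‖ ^ 2 := by ring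
    calc _ ≤ M * ‖w‖ ^ 2 + 2 * ‖basedLin L p‖ * ‖w‖ ^ 2 := (norm_add_le _ _).trans (add_le_add e1 e2)
      _ = (M + 2 * ‖basedLin L p‖) * ‖w‖ ^ 2 := by ring
  -- (2) `‖R‖ ≤ θ‖Aw‖` with `θ = (M + 2 * ‖basedLin L p‖)‖w‖/c ≤ (M + 2 * ‖basedLin L p‖)R₁/c ≤ 1/4`
  have hθw : ∀ w : NzSite L → Fin 3 → ℝ, ‖w‖ ≤ R₁ →
      ‖(gaugeModes L).starProjection (basedFn L (gnoParam L w, p)) - laplaceMap L p w‖ ≤ ((M + 2 * ‖basedLin L p‖) * ‖w‖ * (4 * sliceConst L)) * ‖laplaceMap L p w‖ := fun w hw => by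
    have h1 := hrem w hw
    have h2 := hcoer w
    have hw0 : 0 ≤ ‖w‖ := norm_nonneg w
    -- `(M + 2 * ‖basedLin L p‖)‖w‖² = (M + 2 * ‖basedLin L p‖)‖w‖·‖w‖ ≤ (M + 2 * ‖basedLin L p‖)‖w‖·(4C)‖Aw‖`
    have h3 : ‖w‖ ≤ (4 * sliceConst L) * ‖laplaceMap L p w‖ := by
      have : c * ‖w‖ * (4 * sliceConst L) ≤ ‖laplaceMap L p w‖ * (4 * sliceConst L) := mul_le_mul_of_nonneg_right h2 (by positivity)
      rw [mul_comm c, mul_assoc, hcinv, mul_one] at this; linarith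
    calc _ ≤ (M + 2 * ‖basedLin L p‖) * ‖w‖ ^ 2 := h1
      _ = (M + 2 * ‖basedLin L p‖) * ‖w‖ * ‖w‖ := by ring
      _ ≤ (M + 2 * ‖basedLin L p‖) * ‖w‖ * ((4 * sliceConst L) * ‖laplaceMap L p w‖) := mul_le_mul_of_nonneg_left h3 (by positivity)
      _ = ((M + 2 * ‖basedLin L p‖) * ‖w‖ * (4 * sliceConst L)) * ‖laplaceMap L p w‖ := by ring
  -- (3) fat-tube membership on the core, support localisation off `R₁`
  have hU1 : tubePt L p ∈ nearOne L ρ₁ := hU.1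
  have hind_core : ∀ w : NzSite L → Fin 3 → ℝ, ‖w‖ ≤ r →
      gaugeTransform (basedExt L fun y => gnoPoint (w y)) (tubePt L p) ∈ fatTubeRho L δ ρ β := fun w hw => by
    rw [basedExt_gno_eq]
    have hG' : ∀ x, ‖(gnoParam L w : Site 3 L → Fin 3 → ℝ) x‖ ≤ r := fun x =>
      (norm_le_pi_norm _ x).trans ((norm_gnoParam_le L w).trans hw)
    exact gaugeTransform_chart_mem_fatTubeRho L (ρ := fun _ => ρ₁) hU hG' (by linarith) (by simpa using hcore)
  have hsupp0 : ∀ w : NzSite L → Fin 3 → ℝ, fpIntegrand L δ ρ δg β p w ≠ 0 → ‖w‖ ≤ R₁ := fun w hw => by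
    have hmem : gaugeTransform (basedExt L fun y => gnoPoint (w y)) (tubePt L p) ∈ fatTubeRho L δ ρ β :=
      mem_fatTubeRho_of_fpBased_ne_zero L hw
    have h1 : 3 * ((L : ℝ) - 1) * (ρ₁ + ρ β) ≤ 1 := hsupp.trans (by linarith)
    exact (norm_le_of_gno_nearOne L hU1 hmem.1 h1).trans hsupp
  -- (4) the core bounds
  have hG0 : ∀ w, 0 ≤ fpIntegrand L δ ρ δg β p w := fun w => (fpIntegrand_mem_Icc L δ ρ δg β p w).1
  have hη_def : η = 3 * ((M + 2 * ‖basedLin L p‖) * r * (4 * sliceConst L)) := rfl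
  have hθR : (M + 2 * ‖basedLin L p‖) * R₁ * (4 * sliceConst L) ≤ 1 / 4 := hθ
  have hcoreB : ∀ w : NzSite L → Fin 3 → ℝ, ‖w‖ ≤ r →
      Real.exp (-((1 + η) * ‖laplaceMap L p w‖ ^ 2 / s ^ 2)) ≤ fpIntegrand L δ ρ δg β p w ∧ fpIntegrand L δ ρ δg β p w ≤ Real.exp (-((1 - η) * ‖laplaceMap L p w‖ ^ 2 / s ^ 2)) := fun w hw => by
    have hwR : ‖w‖ ≤ R₁ := hw.trans hrR
    obtain ⟨θ, hθdef⟩ : ∃ θ : ℝ, θ = (M + 2 * ‖basedLin L p‖) * ‖w‖ * (4 * sliceConst L) := ⟨_, rfl⟩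
    have hθ0 : 0 ≤ θ := by rw [hθdef]; positivity
    have hθr : θ ≤ (M + 2 * ‖basedLin L p‖) * r * (4 * sliceConst L) := by
      rw [hθdef]; exact mul_le_mul_of_nonneg_right (mul_le_mul_of_nonneg_left hw hM'0) (by positivity)
    have hθ1 : θ ≤ 1 := by
      have : (M + 2 * ‖basedLin L p‖) * r * (4 * sliceConst L) ≤ (M + 2 * ‖basedLin L p‖) * R₁ * (4 * sliceConst L) :=
        mul_le_mul_of_nonneg_right (mul_le_mul_of_nonneg_left hrR hM'0) (by positivity)
      linarith
    have hRw := hθw w hwR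
    rw [← hθdef] at hRw
    obtain ⟨hlo, hhi⟩ := sq_norm_add_sandwich (a := laplaceMap L p w) (R := (gaugeModes L).starProjection (basedFn L (gnoParam L w, p)) - laplaceMap L p w) hθ1 hRw
    rw [add_sub_cancel] at hlo hhi
    have hval : fpIntegrand L δ ρ δg β p w = Real.exp (-(‖(gaugeModes L).starProjection (basedFn L (gnoParam L w, p))‖ ^ 2 / s ^ 2)) := by
      rw [fpIntegrand_eq, Set.indicator_of_mem (hind_core w hw), one_mul]
    rw [hval]
    have hQ0 : 0 ≤ ‖laplaceMap L p w‖ ^ 2 := sq_nonneg _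
    constructor
    · rw [Real.exp_le_exp, neg_le_neg_iff]
      apply div_le_div_of_nonneg_right _ (by positivity)
      calc ‖(gaugeModes L).starProjection (basedFn L (gnoParam L w, p))‖ ^ 2 ≤ (1 + 3 * θ) * ‖laplaceMap L p w‖ ^ 2 := hhi
        _ ≤ (1 + η) * ‖laplaceMap L p w‖ ^ 2 := by apply mul_le_mul_of_nonneg_right _ hQ0; rw [hη_def]; linarith
    · rw [Real.exp_le_exp, neg_le_neg_iff]
      apply div_le_div_of_nonneg_right _ (by positivity)
      calc (1 - η) * ‖laplaceMap L p w‖ ^ 2 ≤ (1 - 2 * θ) * ‖laplaceMap L p w‖ ^ 2 := by apply mul_le_mul_of_nonneg_right _ hQ0; rw [hη_def]; linarith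
        _ ≤ _ := hlo
  -- (5) the off-core bound
  have hoffB : ∀ w : NzSite L → Fin 3 → ℝ, r < ‖w‖ → fpIntegrand L δ ρ δg β p w ≤ Real.exp (-(‖laplaceMap L p w‖ ^ 2 / (2 * s ^ 2))) := fun w hw => by
    by_cases hGz : fpIntegrand L δ ρ δg β p w = 0
    · rw [hGz]; exact (Real.exp_pos _).le
    have hwR : ‖w‖ ≤ R₁ := hsupp0 w hGz
    obtain ⟨θ, hθdef⟩ : ∃ θ : ℝ, θ = (M + 2 * ‖basedLin L p‖) * ‖w‖ * (4 * sliceConst L) := ⟨_, rfl⟩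
    have hθ0 : 0 ≤ θ := by rw [hθdef]; positivity
    have hθ4 : θ ≤ 1 / 4 := by
      have : θ ≤ (M + 2 * ‖basedLin L p‖) * R₁ * (4 * sliceConst L) := by
        rw [hθdef]; exact mul_le_mul_of_nonneg_right (mul_le_mul_of_nonneg_left hwR hM'0) (by positivity)
      linarith
    have hRw := hθw w hwR
    rw [← hθdef] at hRw
    obtain ⟨hlo, -⟩ := sq_norm_add_sandwich (a := laplaceMap L p w) (R := (gaugeModes L).starProjection (basedFn L (gnoParam L w, p)) - laplaceMap L p w) (by linarith) hRw
    rw [add_sub_cancel] at hlo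
    obtain ⟨_, h1⟩ := fpIntegrand_mem_Icc L δ ρ δg β p w
    have hval : fpIntegrand L δ ρ δg β p w ≤ Real.exp (-(‖(gaugeModes L).starProjection (basedFn L (gnoParam L w, p))‖ ^ 2 / s ^ 2)) := by
      rw [fpIntegrand_eq]
      have hind : (fatTubeRho L δ ρ β).indicator (fun _ => (1 : ℝ)) (gaugeTransform (basedExt L fun y => gnoPoint (w y)) (tubePt L p)) ≤ 1 :=
        Set.indicator_le_self' (fun _ _ => zero_le_one) _
      have hind0 : 0 ≤ (fatTubeRho L δ ρ β).indicator (fun _ => (1 : ℝ)) (gaugeTransform (basedExt L fun y => gnoPoint (w y)) (tubePt L p)) :=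
        Set.indicator_nonneg (fun _ _ => zero_le_one) _
      calc _ ≤ 1 * Real.exp (-(‖(gaugeModes L).starProjection (basedFn L (gnoParam L w, p))‖ ^ 2 / s ^ 2)) :=
            mul_le_mul_of_nonneg_right hind (Real.exp_pos _).le
        _ = _ := one_mul _
    refine hval.trans ?_
    rw [Real.exp_le_exp, neg_le_neg_iff, div_le_div_iff₀ (by positivity) (by positivity)]
    have hQ0 : 0 ≤ ‖laplaceMap L p w‖ ^ 2 := sq_nonneg _
    have hs2 : 0 ≤ s ^ 2 := sq_nonneg _
    have hprod := mul_nonneg (show (0 : ℝ) ≤ 1 / 2 - 2 * θ by linarith) hQ0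
    have h5 : ‖laplaceMap L p w‖ ^ 2 ≤ 2 * ‖(gaugeModes L).starProjection (basedFn L (gnoParam L w, p))‖ ^ 2 := by
      have e : (1 - 2 * θ) * ‖laplaceMap L p w‖ ^ 2 = ‖laplaceMap L p w‖ ^ 2 / 2 + (1 / 2 - 2 * θ) * ‖laplaceMap L p w‖ ^ 2 := by ring
      linarith
    calc ‖laplaceMap L p w‖ ^ 2 * s ^ 2 ≤ (2 * ‖(gaugeModes L).starProjection (basedFn L (gnoParam L w, p))‖ ^ 2) * s ^ 2 :=
          mul_le_mul_of_nonneg_right h5 hs2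
      _ = _ := by ring
  exact ⟨hcoer, hcoreB, hoffB, hsupp0⟩

/-- ★★★ **(N2) THE FADDEEV–POPOV WEIGHT AT A SLICE POINT IS SANDWICHED BY GAUSSIANS OF THE LAPLACE LINEAR MAP.** [cite: Luscher1983, §3] -/
theorem fpWeight_laplace_bounds (hL : Nonempty (NzSite L)) {δ ρ δg : ℝ → ℝ} {β : ℝ} (hs : 0 < δg β)
    (p : balancedSubmodule L × (Fin 3 → Fin 3 → ℝ))
    -- tool-chain radii and constants
    {εT M : ℝ} (hM0 : 0 ≤ M) (hεT : 0 < εT)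
    (hT : ∀ (ξ : basedSubmodule L) (q : balancedSubmodule L × (Fin 3 → Fin 3 → ℝ)), ‖ξ‖ < εT → ‖q‖ < εT →
      ‖basedFn L (ξ, q) - basedFn L (0, q) - basedLin L q ξ‖ ≤ M * ‖ξ‖ ^ 2)
    {εC : ℝ} (hC : ∀ q : balancedSubmodule L × (Fin 3 → Fin 3 → ℝ), ‖q‖ < εC →
      ∀ ξ : basedSubmodule L, ‖ξ‖ ≤ 4 * sliceConst L * ‖(gaugeModes L).starProjection (basedLin L q ξ)‖)
    (hpT : ‖p‖ < εT) (hpC : ‖p‖ < εC) (hp40 : ‖p‖ ≤ 1 / 40)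
    -- slice condition and fat-tube membership of the tube point
    (hslice : (gaugeModes L).starProjection (linkEmbed L (p.1 : Edge 3 L → Fin 3 → ℝ)) = 0)
    {ρ₁ : ℝ} (hU : tubePt L p ∈ fatTubeRho L δ (fun _ => ρ₁) β)
    -- radii
    {r R₁ : ℝ} (hr0 : 0 ≤ r) (hrR : r ≤ R₁) (hR1 : R₁ ≤ 1 / 2) (hR1T : R₁ < εT) (hcore : ρ₁ + 8 * r ≤ ρ β)
    (hsupp : 3 * ((L : ℝ) - 1) * (ρ₁ + ρ β) ≤ R₁)
    (hθ : (M + 2 * ‖basedLin L p‖) * R₁ * (4 * sliceConst L) ≤ 1 / 4) :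
    let n := Fintype.card (NzSite L)
    let s := δg β
    let c := 1 / (4 * sliceConst L)
    let η := 3 * ((M + 2 * ‖basedLin L p‖) * r * (4 * sliceConst L))
    let I := fun a : ℝ => ∫ w, Real.exp (-(a * ‖laplaceMap L p w‖ ^ 2 / s ^ 2))
    ((2 * π ^ 2)⁻¹) ^ n * Real.exp (-(6 * n * R₁ ^ 2)) * (I (1 + η) - Real.exp (-(c ^ 2 * r ^ 2 / (2 * s ^ 2))) * I (1 / 2)) ≤
        gaugeAvg (recordWeightRho L δ ρ δg β) (tubePt L p) ∧
      gaugeAvg (recordWeightRho L δ ρ δg β) (tubePt L p) ≤ ((2 * π ^ 2)⁻¹) ^ n * (I (1 - η) + Real.exp (-(c ^ 2 * r ^ 2 / (4 * s ^ 2))) * I (1 / 4)) := by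
  intro n s c η I
  classical
  haveI := hL
  have hCpos := sliceConst_pos L
  have hM'0 : 0 ≤ (M + 2 * ‖basedLin L p‖) := by positivity
  have hc0 : 0 < c := by show 0 < 1 / (4 * sliceConst L); positivity
  have hθR : (M + 2 * ‖basedLin L p‖) * R₁ * (4 * sliceConst L) ≤ 1 / 4 := hθ
  have hη_def : η = 3 * ((M + 2 * ‖basedLin L p‖) * r * (4 * sliceConst L)) := rfl
  have hU1 : tubePt L p ∈ nearOne L ρ₁ := hU.1
  obtain ⟨hcoer, hcoreB, hoffB, hsupp0⟩ := fpIntegrand_envelope_hyps L hL hs p hM0 hεT hT hC hpT hpC hp40 hslice hU hr0 hrR hR1 hR1T hcore hsupp hθ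
  have hG0 : ∀ w, 0 ≤ fpIntegrand L δ ρ δg β p w := fun w => (fpIntegrand_mem_Icc L δ ρ δg β p w).1
  -- (6) the flat sandwich
  have hθr4 : (M + 2 * ‖basedLin L p‖) * r * (4 * sliceConst L) ≤ 1 / 4 :=
    (mul_le_mul_of_nonneg_right (mul_le_mul_of_nonneg_left hrR hM'0) (by positivity)).trans hθR
  have hη0 : 0 ≤ η := by rw [hη_def]; positivity
  have hηlt : η < 1 := by rw [hη_def]; linarith
  obtain ⟨hlow, hupp⟩ := laplace_sandwich (laplaceMap L p) (c := c) (s := s) (r := r) (η := η) (G := fpIntegrand L δ ρ δg β p)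
    hc0 hs hr0 hη0 hηlt hcoer (measurable_fpIntegrand L δ ρ δg β p) hG0 hcoreB hoffB
  -- (7) from the flat integral to the based Haar integral: gnomonic density sandwich
  have hI : ∀ a : ℝ, 0 < a → Integrable (fun w : NzSite L → Fin 3 → ℝ => Real.exp (-(a * ‖laplaceMap L p w‖ ^ 2 / s ^ 2))) := fun a ha =>
    integrable_exp_neg_quad (laplaceMap L p) hc0 hs ha hcoer
  have hGint : Integrable (fpIntegrand L δ ρ δg β p) := by
    have hup := laplace_upper_envelope (laplaceMap L p) (c := c) (s := s) (r := r) (η := η) (G := fpIntegrand L δ ρ δg β p) hc0 hr0 hcoer hcoreB hoffB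
    have hU : Integrable (fun w : NzSite L → Fin 3 → ℝ => Real.exp (-((1 - η) * ‖laplaceMap L p w‖ ^ 2 / s ^ 2)) +
        Real.exp (-(c ^ 2 * r ^ 2 / (4 * s ^ 2))) * Real.exp (-(1 / 4 * ‖laplaceMap L p w‖ ^ 2 / s ^ 2))) :=
      (hI (1 - η) (sub_pos.mpr hηlt)).add ((hI (1 / 4) (by norm_num)).const_mul (Real.exp (-(c ^ 2 * r ^ 2 / (4 * s ^ 2)))))
    have hbound : ∀ w : NzSite L → Fin 3 → ℝ, ‖fpIntegrand L δ ρ δg β p w‖ ≤ Real.exp (-((1 - η) * ‖laplaceMap L p w‖ ^ 2 / s ^ 2)) +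
        Real.exp (-(c ^ 2 * r ^ 2 / (4 * s ^ 2))) * Real.exp (-(1 / 4 * ‖laplaceMap L p w‖ ^ 2 / s ^ 2)) := fun w => by
      have h1 : ‖fpIntegrand L δ ρ δg β p w‖ = fpIntegrand L δ ρ δg β p w := Real.norm_of_nonneg (hG0 w)
      exact h1.le.trans (hup w)
    exact hU.mono' (measurable_fpIntegrand L δ ρ δg β p).aestronglyMeasurable (ae_of_all _ hbound)
  -- the based average in the vacuum chart
  have hN : gaugeAvg (recordWeightRho L δ ρ δg β) (tubePt L p) = ∫ w, piGnDensityReal (NzSite L) w * fpIntegrand L δ ρ δg β p w :=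
    gaugeAvg_eq_integral_fpIntegrand L p hU1 (lt_of_le_of_lt hsupp (by linarith only [hR1]))
  -- density bounds
  have hb2 : ∀ w : NzSite L → Fin 3 → ℝ, ‖piGnDensityReal (NzSite L) w * fpIntegrand L δ ρ δg β p w‖ ≤ ((2 * π ^ 2)⁻¹) ^ n * fpIntegrand L δ ρ δg β p w :=
    fun w => by
      obtain ⟨hd0, hd1⟩ := piGnDensityReal_pos_le (NzSite L) w
      have e : ‖piGnDensityReal (NzSite L) w * fpIntegrand L δ ρ δg β p w‖ = piGnDensityReal (NzSite L) w * fpIntegrand L δ ρ δg β p w :=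
        Real.norm_of_nonneg (mul_nonneg hd0.le (hG0 w))
      exact e.le.trans (mul_le_mul_of_nonneg_right hd1 (hG0 w))
  have hdens_int : Integrable fun w : NzSite L → Fin 3 → ℝ => piGnDensityReal (NzSite L) w * fpIntegrand L δ ρ δg β p w :=
    (hGint.const_mul (((2 * π ^ 2)⁻¹) ^ n)).mono' ((measurable_piGnDensityReal (NzSite L)).mul (measurable_fpIntegrand L δ ρ δg β p)).aestronglyMeasurable
      (ae_of_all _ hb2)
  rw [hN]
  constructor
  · -- lower: `dens·G ≥ (2π²)^{-n} e^{−6nR₁²} G` (G vanishes off `‖w‖ ≤ R₁`)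
    have hpt : ∀ w, ((2 * π ^ 2)⁻¹) ^ n * Real.exp (-(6 * n * R₁ ^ 2)) * fpIntegrand L δ ρ δg β p w ≤ piGnDensityReal (NzSite L) w * fpIntegrand L δ ρ δg β p w := fun w => by
      by_cases hGz : fpIntegrand L δ ρ δg β p w = 0
      · rw [hGz, mul_zero, mul_zero]
      have hwR := hsupp0 w hGz
      have hsum : ∑ i, ∑ a, w i a ^ 2 ≤ 3 * n * R₁ ^ 2 := by
        have hw2 : ‖w‖ ^ 2 ≤ R₁ ^ 2 := pow_le_pow_left₀ (norm_nonneg w) hwR 2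
        have hn0 : (0 : ℝ) ≤ 3 * n := by positivity
        calc _ ≤ 3 * Fintype.card (NzSite L) * ‖w‖ ^ 2 := sum_sum_sq_le w
          _ ≤ 3 * n * R₁ ^ 2 := mul_le_mul_of_nonneg_left hw2 hn0
      have h1 := piGnDensityReal_ge_exp (NzSite L) w
      have h2 : Real.exp (-(6 * n * R₁ ^ 2)) ≤ Real.exp (-(2 * ∑ i, ∑ a, w i a ^ 2)) := by
        rw [Real.exp_le_exp]; linarith only [hsum]
      have hπ : 0 ≤ ((2 * π ^ 2)⁻¹ : ℝ) ^ n := by positivity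
      calc _ ≤ ((2 * π ^ 2)⁻¹) ^ n * Real.exp (-(2 * ∑ i, ∑ a, w i a ^ 2)) * fpIntegrand L δ ρ δg β p w :=
            mul_le_mul_of_nonneg_right (mul_le_mul_of_nonneg_left h2 hπ) (hG0 w)
        _ ≤ _ := mul_le_mul_of_nonneg_right h1 (hG0 w)
    have hmono := integral_mono (hGint.const_mul _) hdens_int hpt
    rw [integral_const_mul] at hmono
    refine le_trans ?_ hmono
    have hfac : 0 ≤ ((2 * π ^ 2)⁻¹) ^ n * Real.exp (-(6 * n * R₁ ^ 2)) := by positivity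
    exact mul_le_mul_of_nonneg_left hlow hfac
  · -- upper: `dens ≤ (2π²)^{-n}`
    have hpt : ∀ w, piGnDensityReal (NzSite L) w * fpIntegrand L δ ρ δg β p w ≤ ((2 * π ^ 2)⁻¹) ^ n * fpIntegrand L δ ρ δg β p w := fun w =>
      mul_le_mul_of_nonneg_right (piGnDensityReal_pos_le (NzSite L) w).2 (hG0 w)
    have hmono := integral_mono hdens_int (hGint.const_mul _) hpt
    rw [integral_const_mul] at hmono
    exact hmono.trans (mul_le_mul_of_nonneg_left hupp (by positivity))

end Summit.QuantumFields.YangMills.Theorems.FemtoTransferGap.TwoLattice.ConstTube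

end
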